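import Summits.BirchSwinnertonDyer.BirchSwinnertonDyer.Theorems.ResidualThetaTransportAtTwoRlfTwistedLocalKummerWitness
import Summits.BirchSwinnertonDyer.BirchSwinnertonDyer.Theorems.ResidualThetaTransportAtTwoPlusDualEigenCount
import Literature.NumberTheory.EllipticCurves.SubgroupKummerClass
import Literature.NumberTheory.GaloisRepresentations.HOneRestrictionOntoInvariantsPadic
import Summits.BirchSwinnertonDyer.BirchSwinnertonDyer.Theorems.ResidualThetaTransportAtTwoRlfTwistedUniformExponent
import HarnessLib

/-!
# Route `ResidualThetaTransportAtTwo` (RTT P6, item stmt-BirchSwinnertonDyer-23110, road T), H-PLUSDUAL brick (K1b):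
# the TWISTED signed local Kummer condition at `2` has exactly `2^J` classes

Width seat `bsd-wall-tp2-p2x-w2` g15 (cell `bsd-wall`), for the LEAD `bsd-wall-tp2-p2x` g12. HONEST FRAMING: THEOREMS ONLY
(no definition, no named fact, no instance, no `sorry`); closes no item; BSD is NOT proved by any of this.

Setting as in `…RlfTwistedLocalKummerWitness`: `W/ℚ` globally minimal, good supersingular at `2` with `a₂(W) = 0`, `κ` the
cyclotomic `ℤ₂`-extension, `v ∋ 2`, `N = Gal(ℚ̄_v/ℚ_{v,∞})`, `A = ⋃ₙ E⁺(ℚ_{v,n})`, `u` odd, `M_u = E[2^J](χ_u)`,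
`L_u = twistedTorsionLocalKummer 2 κ J u hu ℚ_v A ≤ H¹(ℚ_v, M_u)`.

## What is proved (B. D. Kim 2007, Props. 3.15–3.18 read at `2`, twisted, level `ℚ_v`: `#H₀^±[2^J](χ_u) = 2^J`)
* `exists_witness_of_eigen` — every `r ∈ A` with `g r ≡ u' r (2^J A)` is `2^J Q` for a witness `(ψ, Q, J)` of a class of `L_u`:
  the Kummer cocycle of `Q` on `N` (`WeierstrassCurve.subgroupKummerCocycle`) is a cocycle of the twisted module (`χ_u ≡ 1` on `N`)
  whose class is fixed by the TWISTED conjugation `conj_g`, hence extends over the `ℤ₂`-quotient `Γ_{ℚ_v}/N`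
  (`exists_resSubgroup_eq_of_conjMap_eq_of_padicInt`, `cd₂ ℤ₂ = 1`).
* **`natCard_twistedTorsionLocalKummer_two`: `Nat.card L_u = 2^J`** — the dictionary of `…RlfTwistedLocalKummerWitness` is a
  bijection onto the residue system of `PlusDualTwo.exists_residueSystem_plusEigen_two` (K2: `#(A/2^J A)^{g = u'} = 2^J`, from
  `(H⁺)^∨ ≅ Λ` at `2`). With `TwistedLocalCount.natCard_galoisCohomology_one_twistedTorsion_two` (`#H¹(ℚ_v, M_u) = 4^J`) this is
  the counting half of H-PLUSDUAL (`#L_u · #L_{u'} = #H¹`).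

References: B. D. Kim, Compositio Math. 143 (2007), §3.3 Props. 3.15–3.18 [BDKim2007]; S. Kobayashi, Invent. math. 152 (2003),
Def. 1.1, (8.23) [Kobayashi2003]; R. Greenberg, LNM 1716 (1999), §3–§4 (inflation–restriction for `Γ ≅ ℤ_p`, p. 124) [GreenbergLNM1716];
J.-P. Serre, *Galois Cohomology* I §2.6 (b) [SerreGaloisCohomology1997]; L. Washington, *Cyclotomic Fields* §13.1 [Washington1997].
-/

-- the Theorems namespace of this sub repeats the summit name by design (D-0017 nested layout)
set_option linter.dupNamespace false

noncomputable section

open scoped Classical NumberField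
open CategoryTheory Function Field NumberField IsDedekindDomain

namespace Summit.BirchSwinnertonDyer.BirchSwinnertonDyer.Theorems.SignedEC.TwistedLocalKummer

open Literature.NumberTheory.EllipticCurves Literature.NumberTheory.GaloisRepresentations WeierstrassCurve ZpExtension
  Literature.NumberTheory.EllipticCurves.Kobayashi2003 Literature.NumberTheory.EllipticCurves.Sprung2012
  Summit.BirchSwinnertonDyer.Rank1Residual.Additive
open scoped ContRepresentation

universe u

variable (W : WeierstrassCurve ℚ) [W.IsElliptic] [W.IsGloballyMinimal]

/-! ## §2 (continued) Surjectivity of the dictionary onto the eigen-classes -/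

omit [W.IsGloballyMinimal] in
/-- **(T5) every eigen-point is the point of a witness** (`res : H¹(ℚ_v, M_u) → H¹(N, M_u)^{g}` is onto, `Γ_{ℚ_v}/N ≅ ℤ₂`):
for `r ∈ A` with `g r − u' r ∈ 2^J A` (`u u' ≡ 1 (2^J)`) there is a cocycle `ψ` of `M_u|_{Γ_{ℚ_v}}` and a root `Q`, `2^J Q = r`,
with `ψ|_N = (τ ↦ τQ − Q)` on points — so `[ψ] ∈ L_u`. The Kummer cocycle `κ_N(Q)` of `Q` on `N` is a cocycle of the twisted
module (`χ_u ≡ 1` on `N`) whose class is fixed by the TWISTED conjugation `conj_g` (`u·g κ_N(Q)(g⁻¹τg) − κ_N(Q)(τ) = τT − T` with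
`T = u·gQ − Q − a₀` torsion, `2^J(u·gQ − Q) = u·g r − r = 2^J a₀`, `a₀ ∈ A`), hence extends to `Γ_{ℚ_v}`
(`exists_resSubgroup_eq_of_conjMap_eq_of_padicInt`). [cite: BDKim2007, Prop. 3.18] [cite: GreenbergLNM1716, §4 p. 124]
[cite: SerreGaloisCohomology1997, I §2.6 (b)] -/
theorem exists_witness_of_eigen (κ : ZpExtension ℚ 2) (J : ℕ) {u u' : ℤ}
    (hu : (2 : ℤ) ∣ u - 1) (huu' : ((2 : ℤ) ^ J) ∣ u * u' - 1)
    (v : HeightOneSpectrum (𝓞 ℚ)) {g : absoluteGaloisGroup (v.adicCompletion ℚ)}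
    (hg : κ.IsTopGenerator (resGalOfEmb (closureEmb (K := ℚ) (v.adicCompletion ℚ)) g))
    {r : localPoints W (v.adicCompletion ℚ)} (hr : r ∈ ⨆ n, signedLocalPoints κ (v.adicCompletion ℚ) W 1 n)
    (heig : ∃ w ∈ (⨆ n, signedLocalPoints κ (v.adicCompletion ℚ) W 1 n), g • r - u' • r = 2 ^ J • w) :
    ∃ (ψ : contOneCocycles ((W.twistedTorsionGaloisModule 2 κ J u hu).restrictField (v.adicCompletion ℚ)).toTopRep)
      (Q : localPoints W (v.adicCompletion ℚ)), 2 ^ J • Q = r ∧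
      ∀ τ : localSubgroup κ.kerSubgroup (v.adicCompletion ℚ),
        pointsMap W (v.adicCompletion ℚ)
            ((ψ.1 (τ : absoluteGaloisGroup (v.adicCompletion ℚ)) : W.geomTorsion ((2 ^ J : ℕ) : ℤ)) : W.geomPoints) =
          (τ : absoluteGaloisGroup (v.adicCompletion ℚ)) • Q - Q := by
  haveI : Fact (Nat.Prime 2) := ⟨Nat.prime_two⟩
  let G := absoluteGaloisGroup (v.adicCompletion ℚ)
  let Pt := localPoints W (v.adicCompletion ℚ)
  let N : Subgroup G := localSubgroup κ.kerSubgroup (v.adicCompletion ℚ)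
  set A : AddSubgroup Pt := ⨆ n, signedLocalPoints κ (v.adicCompletion ℚ) W 1 n with hAdef
  haveI : CompactSpace G := absoluteGaloisGroup_compactSpace (v.adicCompletion ℚ)
  let n : ℤ := ((2 ^ J : ℕ) : ℤ)
  have hn : n ≠ 0 := by
    change ((2 ^ J : ℕ) : ℤ) ≠ 0
    exact_mod_cast pow_ne_zero J two_ne_zero
  let B := W.geomTorsion n
  let X : ContinuousRep G ℤ B := (W.twistedTorsionGaloisModule 2 κ J u hu).restrictField (v.adicCompletion ℚ)
  let ι : B → Pt := fun b ↦ pointsMap W (v.adicCompletion ℚ) (b : W.geomPoints)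
  let θ : B ≃+ AddSubgroup.torsionBy Pt n := W.torsionPointsEquiv n (E := v.adicCompletion ℚ) hn
  have galois_smul_nsmul : ∀ (τ : G) (k : ℕ) (P : Pt), τ • (k • P) = k • (τ • P) :=
    fun τ k P ↦ map_nsmul (DistribSMul.toAddMonoidHom Pt τ) k P
  have galois_smul_zsmul : ∀ (τ : G) (k : ℤ) (P : Pt), τ • (k • P) = k • (τ • P) :=
    fun τ k P ↦ map_zsmul (DistribSMul.toAddMonoidHom Pt τ) k P
  have hιinj : Function.Injective ι := fun a b hab ↦ θ.injective (Subtype.ext hab)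
  have hιadd : ∀ a b : B, ι (a + b) = ι a + ι b := fun a b ↦ by
    change pointsMap W _ ((a : W.geomPoints) + b) = _; rw [map_add]
  have hιsub : ∀ a b : B, ι (a - b) = ι a - ι b := fun a b ↦ by
    change pointsMap W _ ((a : W.geomPoints) - b) = _; rw [map_sub]
  have hιzsmul : ∀ (c : ℤ) (a : B), ι (c • a) = c • ι a := fun c a ↦ by
    change pointsMap W _ (((c • a : B) : W.geomPoints)) = _
    rw [AddSubgroupClass.coe_zsmul, map_zsmul]
  have hιnsmul : ∀ (c : ℕ) (a : B), ι (c • a) = c • ι a := fun c a ↦ by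
    change pointsMap W _ (((c • a : B) : W.geomPoints)) = _
    rw [AddSubgroupClass.coe_nsmul, map_nsmul]
  have hιgal : ∀ (σ : G) (a : B), ι (resGal (K := ℚ) (v.adicCompletion ℚ) σ • a) = σ • ι a := fun σ a ↦ by
    change pointsMap W _ (((resGal (K := ℚ) (v.adicCompletion ℚ) σ • a : B) : W.geomPoints)) = _
    rw [Literature.NumberTheory.EllipticCurves.AddSubgroup.torsionBy.coe_smul, pointsMap_smul]
  have hιθsymm : ∀ T : AddSubgroup.torsionBy Pt n, ι (θ.symm T) = T := fun T ↦ W.pointsMap_torsionPointsEquiv_symm n hn T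
  have hXN : ∀ {σ : G}, σ ∈ N → ∀ m : B, X σ m = resGal (K := ℚ) (v.adicCompletion ℚ) σ • m :=
    fun hσ m ↦ twistedTorsion_restrictField_apply_of_mem W κ J u hu v hσ m
  have hXg : ∀ m : B, X g m = u • (resGal (K := ℚ) (v.adicCompletion ℚ) g • m) :=
    fun m ↦ twistedTorsion_restrictField_apply_of_isTopGenerator W κ J u hu v hg m
  have hAtower : A ≤ localTowerPointsOfEmb κ (closureEmb (K := ℚ) (v.adicCompletion ℚ)) W :=
    PlusDualTwo.iSup_signedLocalPoints_le_localTowerPointsOfEmb W κ v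
  have h2J : ∀ P : Pt, n • P = 2 ^ J • P := fun P ↦ natCast_zsmul P (2 ^ J)
  -- the root `Q` of `r` and its Kummer cocycle on `N`
  let Q : Pt := W.subgroupZSMulRoot n hn r
  have hQr : 2 ^ J • Q = r := by rw [← h2J]; exact W.zsmul_subgroupZSMulRoot n hn r
  have hQN : n • Q ∈ FixedPoints.addSubgroup N Pt := by
    rw [h2J, hQr]; exact hAtower hr
  let κ₀ := W.subgroupKummerCocycle n N hn Q hQN
  have hκ₀ : ∀ τ : N, ι (κ₀.1 τ) = (τ : G) • Q - Q := fun τ ↦ W.pointsMap_subgroupKummerCocycle_apply n N hn Q hQN τ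
  let cQ : contOneCocycles (subgroupRep X.toTopRep N) :=
    ⟨κ₀.1, fun a b ↦ by
      have h := κ₀.2 a b
      change κ₀.1 (a * b) = κ₀.1 a + X (a : G) (κ₀.1 b)
      rw [hXN a.2]
      exact h⟩
  have hcQ : ∀ τ : N, ι (cQ.1 τ) = (τ : G) • Q - Q := hκ₀
  -- `2^J (u·gQ − Q) = 2^J a₀`, `a₀ = u w + m r ∈ A`
  obtain ⟨w, hw, hwe⟩ := heig
  obtain ⟨m, hm⟩ := huu'
  have hgr : g • r ∈ A := PlusDualTwo.smul_mem_iSup_signedLocalPoints W κ v g hr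
  set a₀ : Pt := u • w + m • r with ha₀
  have ha₀A : a₀ ∈ A := add_mem (A.zsmul_mem hw u) (A.zsmul_mem hr m)
  have hnm : n * m = u * u' - 1 := by
    rw [hm]
    change ((2 ^ J : ℕ) : ℤ) * m = 2 ^ J * m
    push_cast
    ring
  have h2a₀ : 2 ^ J • (u • (g • Q) - Q) = 2 ^ J • a₀ := by
    rw [smul_sub, smul_comm (2 ^ J) u, ← galois_smul_nsmul, hQr, ha₀, smul_add, smul_comm (2 ^ J) u, ← hwe,
      ← h2J (m • r), smul_smul, hnm, sub_smul, one_smul, mul_smul, smul_sub u]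
    abel
  have hT : u • (g • Q) - Q - a₀ ∈ AddSubgroup.torsionBy Pt n := by
    refine (Submodule.mem_torsionBy_iff _ _).mpr ?_
    change n • (u • (g • Q) - Q - a₀) = 0
    rw [h2J, smul_sub, h2a₀, sub_self]
  let bT : B := θ.symm ⟨_, hT⟩
  have hιbT : ι bT = u • (g • Q) - Q - a₀ := hιθsymm ⟨_, hT⟩
  have ha₀N : ∀ τ : G, τ ∈ N → τ • a₀ = a₀ := (mem_localTowerPointsOfEmb_iff κ _ W a₀).1 (hAtower ha₀A)
  -- the class of `cQ` is fixed by the twisted conjugation `conj_g`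
  have hinv : conjMap X.toTopRep N g 1 (oneCocycleClass _ cQ) = oneCocycleClass _ cQ := by
    rw [conjMap_oneCocycleClass, ← sub_eq_zero, ← oneCocycleClass_sub, oneCocycleClass_eq_zero_iff]
    refine ⟨bT, fun τ ↦ ?_⟩
    rw [Submodule.coe_sub, ContinuousMap.sub_apply, conj_pullback_apply]
    change X g (cQ.1 (subgroupConj N g τ)) - cQ.1 τ = X (τ : G) bT - bT
    apply hιinj
    rw [hιsub, hXg, hιzsmul, hιgal, hcQ, hcQ, hιsub, hXN τ.2, hιgal, hιbT]
    have hconjτ : ((subgroupConj N g τ : N) : G) = g⁻¹ * τ * g := subgroupConj_apply_coe N g τ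
    rw [hconjτ]
    have e5 : g • ((g⁻¹ * (τ : G) * g) • Q) = (τ : G) • g • Q := by
      rw [← mul_smul, ← mul_assoc, ← mul_assoc, mul_inv_cancel, one_mul, mul_smul]
    rw [smul_sub g, e5, smul_sub (τ : G), smul_sub (τ : G), ha₀N _ τ.2, galois_smul_zsmul, smul_sub u]
    abel
  -- extend over `Γ_{ℚ_v}/N ≅ ℤ₂`
  have hBprim : ∀ b : B, ∃ e : ℕ, 2 ^ e • b = 0 := fun b ↦ ⟨J, W.pow_nsmul_geomTorsion_pow 2 J b⟩
  let κE : G →ₜ* Multiplicative ℤ_[2] := κ.toContinuousMonoidHom.comp (resGal (K := ℚ) (v.adicCompletion ℚ))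
  have hL : ∀ σ : G, σ ∈ N ↔ κE σ = 1 := fun σ ↦ Iff.rfl
  have hg1 : κE g = Multiplicative.ofAdd 1 := hg
  obtain ⟨xc, hxc⟩ := exists_resSubgroup_eq_of_conjMap_eq_of_padicInt X hBprim κE N hL hg1 (oneCocycleClass _ cQ) hinv
  obtain ⟨ξ, rfl⟩ := oneCocycleClass_surjective _ xc
  rw [resSubgroup_oneCocycleClass, ← sub_eq_zero, ← oneCocycleClass_sub, oneCocycleClass_eq_zero_iff] at hxc
  obtain ⟨b, hb⟩ := hxc
  have hb' : ∀ τ : N, ι (ξ.1 (τ : G)) = (τ : G) • (Q + ι b) - (Q + ι b) := by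
    intro τ
    have h := hb τ
    rw [Submodule.coe_sub, ContinuousMap.sub_apply, resSubgroup_pullback_apply] at h
    change ξ.1 (τ : G) - cQ.1 τ = X (τ : G) b - b at h
    rw [sub_eq_iff_eq_add] at h
    rw [h, hιadd, hιsub, hXN τ.2, hιgal, hcQ, smul_add]
    abel
  refine ⟨ξ, Q + ι b, ?_, hb'⟩
  rw [smul_add, hQr, ← hιnsmul, W.pow_nsmul_geomTorsion_pow 2 J b]
  change r + pointsMap W _ ((0 : B) : W.geomPoints) = r
  rw [ZeroMemClass.coe_zero, map_zero, add_zero]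

/-! ## §3 The count `#L_u = 2^J` -/

/-- **(K1) `#L_u = 2^J`: the twisted signed local Kummer condition at `2` has exactly `2^J` classes** (B. D. Kim's
`#H₀^±[p^j](χ) = p^j`, read at `2`, twisted, level `ℚ_v`). For `W/ℚ` globally minimal with good supersingular reduction at `2` and
`a₂ = 0`, `κ` cyclotomic, `v ∋ 2`, `u` odd and every `J`:
`Nat.card (twistedTorsionLocalKummer 2 κ J u hu ℚ_v (⋃ₙ E⁺(ℚ_{v,n}))) = 2^J`. Proof: `y ↦ (2^J Q_y mod 2^J A)` is a bijection
onto the `(g = u')`-eigen-classes of `A/2^J A` (§2), which number `2^J` (`PlusDualTwo.exists_residueSystem_plusEigen_two`).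
[cite: BDKim2007, Props. 3.15, 3.17, 3.18] [cite: Kobayashi2003, Def. 1.1, (8.23)] -/
theorem natCard_twistedTorsionLocalKummer_two (hss : Rank1Residual.GoodSS W 2) (ha : W.frobeniusTrace 2 = 0)
    {κ : ZpExtension ℚ 2} (hκ : κ.IsCyclotomic) (J : ℕ) (u : ℤ) (hu : (2 : ℤ) ∣ u - 1)
    (v : HeightOneSpectrum (𝓞 ℚ)) (hv : (2 : 𝓞 ℚ) ∈ v.asIdeal) :
    Nat.card (W.twistedTorsionLocalKummer 2 κ J u hu (v.adicCompletion ℚ)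
      (⨆ n, signedLocalPoints κ (v.adicCompletion ℚ) W 1 n)) = 2 ^ J := by
  haveI : Fact (Nat.Prime 2) := ⟨Nat.prime_two⟩
  let G := absoluteGaloisGroup (v.adicCompletion ℚ)
  let Pt := localPoints W (v.adicCompletion ℚ)
  let N : Subgroup G := localSubgroup κ.kerSubgroup (v.adicCompletion ℚ)
  set A : AddSubgroup Pt := ⨆ n, signedLocalPoints κ (v.adicCompletion ℚ) W 1 n with hAdef
  set L := W.twistedTorsionLocalKummer 2 κ J u hu (v.adicCompletion ℚ) A with hLdef
  -- a local lift of the topological generator, the inverse twist, the residue system of K2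
  obtain ⟨g, hg⟩ := ZpExtension.IsCyclotomic.exists_isTopGenerator_resGalOfEmb_adicCompletion hκ v (by exact_mod_cast hv)
  obtain ⟨u', hu', huu'⟩ := TwistedPT.exists_inverse_twist (p := 2) hu J
  obtain ⟨R, hRcard, hRA, hReig, hRinj, hRsurj⟩ := PlusDualTwo.exists_residueSystem_plusEigen_two W hss ha hκ v hv hg u' hu' J
  have hRA' : ∀ r : R, (r : Pt) ∈ A := fun r ↦ hRA (Finset.mem_coe.2 r.2)
  -- witnesses of the classes of `L`
  have hwit : ∀ y : L, ∃ (ψ : contOneCocycles ((W.twistedTorsionGaloisModule 2 κ J u hu).restrictField (v.adicCompletion ℚ)).toTopRep)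
      (Q : Pt) (k : ℕ), oneCocycleClass _ ψ = (y : galoisCohomology _ 1) ∧ 2 ^ k • Q ∈ A ∧
      ∀ τ : N, pointsMap W (v.adicCompletion ℚ) ((ψ.1 (τ : G) : W.geomTorsion ((2 ^ J : ℕ) : ℤ)) : W.geomPoints) =
        (τ : G) • Q - Q :=
    fun y ↦ y.2
  choose ψ Q k hψy hkQ hψN using hwit
  -- the residue of `2^J Q_y`
  have hres : ∀ y : L, ∃ r ∈ R, ∃ w ∈ A, 2 ^ J • Q y - r = 2 ^ J • w := fun y ↦
    hRsurj _ (nsmul_mem_of_witness W hss κ J u hu v hv (ψ y) (Q y) (hkQ y) (hψN y))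
      (exists_eigen_of_witness W hss κ J hu huu' v hv hg (ψ y) (Q y) (hkQ y) (hψN y))
  choose f hfR hfw using hres
  let F : L → R := fun y ↦ ⟨f y, hfR y⟩
  have hF : Function.Bijective F := by
    constructor
    · intro y₁ y₂ h
      have hf : f y₁ = f y₂ := congrArg Subtype.val h
      obtain ⟨w₁, hw₁, e₁⟩ := hfw y₁
      obtain ⟨w₂, hw₂, e₂⟩ := hfw y₂
      apply Subtype.ext
      rw [← hψy y₁, ← hψy y₂]
      refine oneCocycleClass_eq_of_witness_sub_mem W hss κ J u hu v hv (ψ y₁) (ψ y₂) (Q y₁) (Q y₂) (hψN y₁) (hψN y₂)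
        ⟨w₁ - w₂, sub_mem hw₁ hw₂, ?_⟩
      rw [smul_sub, ← e₁, ← e₂, hf]
      abel
    · intro r
      obtain ⟨ψr, Qr, hQr, hψr⟩ := exists_witness_of_eigen W κ J hu huu' v hg (hRA' r) (hReig r r.2)
      have hQrA : 2 ^ J • Qr ∈ A := by rw [hQr]; exact hRA' r
      have hmem : oneCocycleClass _ ψr ∈ L := (mem_twistedTorsionLocalKummer_iff A _).2 ⟨ψr, Qr, J, rfl, hQrA, hψr⟩
      refine ⟨⟨_, hmem⟩, Subtype.ext ?_⟩
      set y : L := ⟨_, hmem⟩ with hy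
      change f y = r
      obtain ⟨w, hw, e⟩ := sub_mem_of_witness_of_witness W hss κ J u hu v hv (ψ y) ψr (Q y) Qr (hkQ y) hQrA (hψN y) hψr
        (by rw [hψy y])
      obtain ⟨w', hw', e'⟩ := hfw y
      refine hRinj (f y) (hfR y) r r.2 ⟨w - w', sub_mem hw hw', ?_⟩
      rw [smul_sub, ← e', ← e, hQr]
      abel
  rw [Nat.card_eq_of_bijective F hF, Nat.card_eq_fintype_card, Fintype.card_coe, hRcard]

end Summit.BirchSwinnertonDyer.BirchSwinnertonDyer.Theorems.SignedEC.TwistedLocalKummer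

end
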